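import Literature.Topology.FourManifolds.NonSeparatingSpheres
import Literature.Topology.FourManifolds.ClosedBallProofs
import HarnessLib

/-!
# Budney–Gabai Thm. 3.13: the vacuous case `n = 0` and reduction to the standard target

Companion to `Literature/Topology/FourManifolds/NonSeparatingSpheres.lean`, which vendors
Budney–Gabai 2019, Theorem 3.13 (first sentence) as the named fact
`Literature.Topology.FourManifolds.BudneyGabai2019_thm_3_13`: for every `n`, any two smoothly
embedded `n`-spheres in `S¹ × Sⁿ` with connected complements are carried onto one another by a
self-diffeomorphism of `S¹ × Sⁿ`.

This file records three *proved*, purely formal facts about that statement — the bookkeeping with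
which any discharge of the fact begins; the content of Thm. 3.13 (dual circle, isotopy to
`S¹ × {*}`, drilling, Thm. 3.12 via the half-disc lemma / the Cerf–Palais disc theorem) is not
touched here.

* `not_isConnected_compl_range_sphere_zero` — **there are no non-separating `0`-spheres**:
  `S⁰ = {±e₀} ⊂ ℝ¹`, so `S¹ × S⁰` is two circles, the image of any map `S⁰ → S¹ × S⁰` is finite,
  its complement meets both circles, and the coordinate `(z, x) ↦ x₀ = ±1` (continuous, never `0`)
  separates them.  Hence the case `n = 0` of Thm. 3.13 is vacuous
  (`BudneyGabai2019_thm_3_13_iff_forall_one_le`).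
* `BudneyGabai2019_thm_3_13_of_forall_standardSphere`,
  `BudneyGabai2019_thm_3_13_iff_forall_standardSphere` — **Thm. 3.13 is equivalent to its
  standard-target form for `n ≥ 1`**: every non-separating `n`-sphere is carried onto
  `{1} × Sⁿ = range (standardSphere n)` by some diffeomorphism.  Two such diffeomorphisms compose
  (`Φ₂⁻¹ ∘ Φ₁`) to carry one sphere onto another; the converse is
  `BudneyGabai2019_thm_3_13.exists_image_eq_range_standardSphere` of the main file (`{1} × Sⁿ` is
  itself non-separating for `n ≥ 1`).  This is the shape in which the source proves the theorem (a
  given sphere is made standard) and in which the route item consumes it.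
* `exists_diffeomorph_image_singleton_prod_eq`,
  `exists_image_eq_range_standardSphere_of_image_eq_singleton_prod` — **any fibre `{c} × Sⁿ` is
  as good as the standard one**: the rotation `(z, p) ↦ (c⁻¹z, p)` is a self-diffeomorphism of
  `S¹ × Sⁿ` (Mathlib's Lie group structure on `Circle`) carrying `{c} × Sⁿ` onto `{1} × Sⁿ`; so a
  proof may stop at an arbitrary fibre.
* `isSmoothEmbedding_diffeomorph_comp_circleProdSphere`,
  `isConnected_compl_range_diffeomorph_comp_iff`, `exists_image_range_diffeomorph_comp_eq_iff` —
  **"without loss of generality, after a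
  self-diffeomorphism of `S¹ × Sⁿ`"**: the hypotheses (smooth embedding, connected complement) and
  the conclusion (some diffeomorphism carries the image onto a given target) of Thm. 3.13 are
  invariant under replacing `e` by `Ψ ∘ e` for a self-diffeomorphism `Ψ` (e.g. the end map of an
  ambient isotopy, as in the first step of the printed proof).

## References

* R. Budney, D. Gabai, *Knotted 3-balls in `S⁴`*, arXiv:1912.09029 (v2), §3, Thm. 3.13 (p. 22).
  [BudneyGabai2019]
-/

noncomputable section

open scoped Manifold ContDiff Topology
open Set Function

namespace Literature.Topology.FourManifolds

/-! ### `n = 0`: no `0`-sphere in `S¹ × S⁰` is non-separating -/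

section Zero

/-- A point of `S⁰ ⊂ ℝ¹` has `0`-th coordinate of square `1`. [folklore] -/
private theorem sq_apply_zero_eq_one_of_mem_sphere_zero {x : EuclideanSpace ℝ (Fin 1)}
    (hx : x ∈ Metric.sphere (0 : EuclideanSpace ℝ (Fin 1)) 1) : (x 0) ^ 2 = 1 := by
  have hnorm : ‖x‖ = 1 := by simpa using hx
  have h := EuclideanSpace.real_norm_sq_eq x
  rw [hnorm, Fin.sum_univ_one, one_pow] at h
  exact h.symm

/-- `S⁰ ⊂ ℝ¹` consists of (at most) the two points `±e₀`. [folklore] -/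
private theorem sphere_zero_subset_pair :
    Metric.sphere (0 : EuclideanSpace ℝ (Fin 1)) 1 ⊆
      {EuclideanSpace.single 0 1, EuclideanSpace.single 0 (-1)} := by
  intro x hx
  have hx0 : x 0 = 1 ∨ x 0 = -1 :=
    mul_self_eq_one_iff.mp (by rw [← pow_two]; exact sq_apply_zero_eq_one_of_mem_sphere_zero hx)
  simp only [mem_insert_iff, mem_singleton_iff]
  rcases hx0 with h | h
  · refine Or.inl (PiLp.ext fun i ↦ ?_)
    rw [Subsingleton.elim i 0, h, PiLp.single_apply]
    simp
  · refine Or.inr (PiLp.ext fun i ↦ ?_)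
    rw [Subsingleton.elim i 0, h, PiLp.single_apply]
    simp

/-- `S⁰ ⊂ ℝ¹` is finite (a private copy of the tree's
`Literature.Topology.FourManifolds.finite_sphere_zero` of
`HCobordismIdealCircleLemma83Complement.lean`, kept local to avoid importing the h-cobordism files
here). [folklore] -/
private theorem finite_sphere_zero' : (Metric.sphere (0 : EuclideanSpace ℝ (Fin 1)) 1).Finite :=
  (toFinite _).subset sphere_zero_subset_pair

/-- The circle `S¹` (Mathlib's `Circle`) is infinite: `Circle.argEquiv` identifies it with the
infinite interval `(-π, π]`. [folklore] -/
theorem infinite_circle : Infinite Circle :=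
  Circle.argEquiv.infinite_iff.2 (Set.Ioc.infinite (by linarith [Real.pi_pos]))

/-- **No `0`-sphere in `S¹ × S⁰` is non-separating** (the case `n = 0` of Budney–Gabai Thm. 3.13
is vacuous): for every map `e : S⁰ → S¹ × S⁰` the complement of its image is not connected.
Proof: the image is finite while each circle `S¹ × {±e₀}` is infinite, so the complement contains
points `(z₊, e₀)` and `(z₋, -e₀)`; the continuous coordinate `(z, x) ↦ x₀` takes the values `1`
and `-1` there but never `0` on `S¹ × S⁰`, contradicting the intermediate value property of a
connected set. [folklore] -/
theorem not_isConnected_compl_range_sphere_zero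
    (e : Metric.sphere (0 : EuclideanSpace ℝ (Fin 1)) 1 →
      Circle × Metric.sphere (0 : EuclideanSpace ℝ (Fin 1)) 1) :
    ¬ IsConnected (range e)ᶜ := by
  intro hc
  -- the separating coordinate `(z, x) ↦ x 0`
  let f : Circle × Metric.sphere (0 : EuclideanSpace ℝ (Fin 1)) 1 → ℝ :=
    fun p ↦ (p.2 : EuclideanSpace ℝ (Fin 1)) 0
  have hfc : Continuous f :=
    (EuclideanSpace.proj (0 : Fin 1)).continuous.comp (continuous_subtype_val.comp continuous_snd)
  have hf0 : ∀ p, f p ≠ 0 := fun p h0 ↦ by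
    have h1 : (f p) ^ 2 = 1 := sq_apply_zero_eq_one_of_mem_sphere_zero p.2.2
    rw [h0] at h1
    norm_num at h1
  -- the image of `e` is finite, each circle is infinite: both circles meet the complement
  have hfin : (range e).Finite := by
    haveI : Finite (Metric.sphere (0 : EuclideanSpace ℝ (Fin 1)) 1) :=
      finite_sphere_zero'.to_subtype
    exact finite_range e
  haveI : Infinite Circle := infinite_circle
  have hmeet : ∀ s : Metric.sphere (0 : EuclideanSpace ℝ (Fin 1)) 1,
      ∃ z : Circle, ((z, s) : Circle × Metric.sphere (0 : EuclideanSpace ℝ (Fin 1)) 1) ∈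
        (range e)ᶜ := by
    intro s
    by_contra hzs
    push Not at hzs
    have hsub : range (fun z : Circle ↦
        ((z, s) : Circle × Metric.sphere (0 : EuclideanSpace ℝ (Fin 1)) 1)) ⊆ range e := by
      rintro _ ⟨z, rfl⟩
      simpa [mem_compl_iff] using hzs z
    have hinj : Injective fun z : Circle ↦
        ((z, s) : Circle × Metric.sphere (0 : EuclideanSpace ℝ (Fin 1)) 1) :=
      fun z w h ↦ congrArg Prod.fst h
    exact (infinite_range_of_injective hinj).mono hsub hfin
  have ha : EuclideanSpace.single (0 : Fin 1) (1 : ℝ) ∈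
      Metric.sphere (0 : EuclideanSpace ℝ (Fin 1)) 1 := by
    simp [PiLp.norm_single]
  have hb : EuclideanSpace.single (0 : Fin 1) (-1 : ℝ) ∈
      Metric.sphere (0 : EuclideanSpace ℝ (Fin 1)) 1 := by
    simp [PiLp.norm_single]
  obtain ⟨za, hza⟩ := hmeet ⟨_, ha⟩
  obtain ⟨zb, hzb⟩ := hmeet ⟨_, hb⟩
  have hfa : f (za, ⟨_, ha⟩) = 1 := by simp [f]
  have hfb : f (zb, ⟨_, hb⟩) = -1 := by simp [f]
  -- intermediate value on the (pre)connected image `f '' (range e)ᶜ ∋ -1, 1`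
  have himage : IsPreconnected (f '' (range e)ᶜ) := hc.isPreconnected.image f hfc.continuousOn
  have h0 : (0 : ℝ) ∈ f '' (range e)ᶜ :=
    himage.Icc_subset (mem_image_of_mem f hzb) (mem_image_of_mem f hza)
      ⟨by rw [hfb]; norm_num, by rw [hfa]; norm_num⟩
  obtain ⟨p, -, hp⟩ := h0
  exact hf0 p hp

/-- Budney–Gabai Thm. 3.13 is equivalent to its restriction to `n ≥ 1` (the case `n = 0` is
vacuous, `not_isConnected_compl_range_sphere_zero`). [folklore] -/
theorem BudneyGabai2019_thm_3_13_iff_forall_one_le :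
    BudneyGabai2019_thm_3_13 ↔
      ∀ n : ℕ, 1 ≤ n →
        ∀ (e₁ e₂ : Metric.sphere (0 : EuclideanSpace ℝ (Fin (n + 1))) 1 →
          Circle × Metric.sphere (0 : EuclideanSpace ℝ (Fin (n + 1))) 1),
        Manifold.IsSmoothEmbedding (𝓡 n) ((𝓡 1).prod (𝓡 n)) ∞ e₁ → IsConnected (range e₁)ᶜ →
        Manifold.IsSmoothEmbedding (𝓡 n) ((𝓡 1).prod (𝓡 n)) ∞ e₂ → IsConnected (range e₂)ᶜ →
          ∃ Φ : (Circle × Metric.sphere (0 : EuclideanSpace ℝ (Fin (n + 1))) 1) ≃ₘ⟮(𝓡 1).prod (𝓡 n),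
              (𝓡 1).prod (𝓡 n)⟯ (Circle × Metric.sphere (0 : EuclideanSpace ℝ (Fin (n + 1))) 1),
            Φ '' range e₁ = range e₂ := by
  refine ⟨fun h n _ ↦ h n, fun h n ↦ ?_⟩
  obtain _ | n := n
  · intro e₁ e₂ _ c₁ _ _
    exact absurd c₁ (not_isConnected_compl_range_sphere_zero e₁)
  · exact h (n + 1) n.succ_pos

end Zero

/-! ### Reduction to the standard target `{1} × Sⁿ` -/

section Standard

/-- **The standard-target form implies Budney–Gabai Thm. 3.13**: if for every `n ≥ 1` every
smoothly embedded `n`-sphere in `S¹ × Sⁿ` with connected complement is carried onto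
`{1} × Sⁿ = range (standardSphere n)` by some self-diffeomorphism, then `Diff(S¹ × Sⁿ)` acts
transitively on such spheres for every `n` (`n = 0` is vacuous; for `n ≥ 1` compose
`Φ₂⁻¹ ∘ Φ₁`). [folklore] -/
theorem BudneyGabai2019_thm_3_13_of_forall_standardSphere
    (H : ∀ n : ℕ, 1 ≤ n →
      ∀ e : Metric.sphere (0 : EuclideanSpace ℝ (Fin (n + 1))) 1 →
          Circle × Metric.sphere (0 : EuclideanSpace ℝ (Fin (n + 1))) 1,
        Manifold.IsSmoothEmbedding (𝓡 n) ((𝓡 1).prod (𝓡 n)) ∞ e → IsConnected (range e)ᶜ →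
          ∃ Φ : (Circle × Metric.sphere (0 : EuclideanSpace ℝ (Fin (n + 1))) 1) ≃ₘ⟮(𝓡 1).prod (𝓡 n),
              (𝓡 1).prod (𝓡 n)⟯ (Circle × Metric.sphere (0 : EuclideanSpace ℝ (Fin (n + 1))) 1),
            Φ '' range e = range (standardSphere n)) :
    BudneyGabai2019_thm_3_13 := by
  rw [BudneyGabai2019_thm_3_13_iff_forall_one_le]
  intro n hn e₁ e₂ h₁ c₁ h₂ c₂
  obtain ⟨Φ₁, hΦ₁⟩ := H n hn e₁ h₁ c₁
  obtain ⟨Φ₂, hΦ₂⟩ := H n hn e₂ h₂ c₂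
  refine ⟨Φ₁.trans Φ₂.symm, ?_⟩
  rw [Diffeomorph.coe_trans, image_comp, hΦ₁, ← hΦ₂, Diffeomorph.symm_image_image]

/-- **Budney–Gabai Thm. 3.13 ⇔ its standard-target form for `n ≥ 1`**: `Diff(S¹ × Sⁿ)` is
transitive on the non-separating smoothly embedded `n`-spheres for all `n` iff, for every `n ≥ 1`,
every such sphere is carried onto `{1} × Sⁿ` by a self-diffeomorphism of `S¹ × Sⁿ` (forward:
`BudneyGabai2019_thm_3_13.exists_image_eq_range_standardSphere`; backward:
`BudneyGabai2019_thm_3_13_of_forall_standardSphere`). [folklore] -/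
theorem BudneyGabai2019_thm_3_13_iff_forall_standardSphere :
    BudneyGabai2019_thm_3_13 ↔
      ∀ n : ℕ, 1 ≤ n →
        ∀ e : Metric.sphere (0 : EuclideanSpace ℝ (Fin (n + 1))) 1 →
            Circle × Metric.sphere (0 : EuclideanSpace ℝ (Fin (n + 1))) 1,
          Manifold.IsSmoothEmbedding (𝓡 n) ((𝓡 1).prod (𝓡 n)) ∞ e → IsConnected (range e)ᶜ →
            ∃ Φ : (Circle × Metric.sphere (0 : EuclideanSpace ℝ (Fin (n + 1))) 1) ≃ₘ⟮
                (𝓡 1).prod (𝓡 n), (𝓡 1).prod (𝓡 n)⟯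
                  (Circle × Metric.sphere (0 : EuclideanSpace ℝ (Fin (n + 1))) 1),
              Φ '' range e = range (standardSphere n) :=
  ⟨fun h _ hn e he hc ↦ h.exists_image_eq_range_standardSphere hn e he hc,
    BudneyGabai2019_thm_3_13_of_forall_standardSphere⟩

end Standard

/-! ### Any fibre `{c} × Sⁿ` can be rotated onto the standard one -/

section Rotate

variable (n : ℕ)

/-- **Rotating a fibre onto the standard fibre**: for every `c ∈ S¹` there is a self-diffeomorphism
`R` of `S¹ × Sⁿ` — the rotation `(z, p) ↦ (c⁻¹ z, p)`, smooth by the Lie group structure of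
`Circle` — with `R({c} × A) = {1} × A` for every `A ⊆ Sⁿ`. [folklore] -/
theorem exists_diffeomorph_image_singleton_prod_eq (c : Circle) :
    ∃ R : (Circle × Metric.sphere (0 : EuclideanSpace ℝ (Fin (n + 1))) 1) ≃ₘ⟮(𝓡 1).prod (𝓡 n),
        (𝓡 1).prod (𝓡 n)⟯ (Circle × Metric.sphere (0 : EuclideanSpace ℝ (Fin (n + 1))) 1),
      ∀ A : Set (Metric.sphere (0 : EuclideanSpace ℝ (Fin (n + 1))) 1),
        R '' (({c} : Set Circle) ×ˢ A) = ({1} : Set Circle) ×ˢ A := by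
  let L : Circle ≃ₘ⟮𝓡 1, 𝓡 1⟯ Circle :=
    { toEquiv := Equiv.mulLeft c⁻¹
      contMDiff_toFun := contMDiff_mul_left
      contMDiff_invFun := contMDiff_mul_left }
  refine ⟨L.prodCongr (Diffeomorph.refl (𝓡 n) _ ∞), fun A ↦ ?_⟩
  rw [Diffeomorph.coe_prodCongr, prodMap_image_prod, image_singleton, Diffeomorph.coe_refl,
    image_id]
  congr 1
  change ({c⁻¹ * c} : Set Circle) = {1}
  rw [inv_mul_cancel]

/-- **A proof of Thm. 3.13 may stop at any fibre**: if a diffeomorphism `Φ` of `S¹ × Sⁿ` carries a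
set `A` onto some fibre `{c} × Sⁿ`, then another one carries `A` onto the standard sphere
`{1} × Sⁿ = range (standardSphere n)` (compose with the rotation of
`exists_diffeomorph_image_singleton_prod_eq`). [folklore] -/
theorem exists_image_eq_range_standardSphere_of_image_eq_singleton_prod
    {A : Set (Circle × Metric.sphere (0 : EuclideanSpace ℝ (Fin (n + 1))) 1)}
    (Φ : (Circle × Metric.sphere (0 : EuclideanSpace ℝ (Fin (n + 1))) 1) ≃ₘ⟮(𝓡 1).prod (𝓡 n),
        (𝓡 1).prod (𝓡 n)⟯ (Circle × Metric.sphere (0 : EuclideanSpace ℝ (Fin (n + 1))) 1))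
    (c : Circle) (hΦ : Φ '' A = ({c} : Set Circle) ×ˢ univ) :
    ∃ Φ' : (Circle × Metric.sphere (0 : EuclideanSpace ℝ (Fin (n + 1))) 1) ≃ₘ⟮(𝓡 1).prod (𝓡 n),
        (𝓡 1).prod (𝓡 n)⟯ (Circle × Metric.sphere (0 : EuclideanSpace ℝ (Fin (n + 1))) 1),
      Φ' '' A = range (standardSphere n) := by
  obtain ⟨R, hR⟩ := exists_diffeomorph_image_singleton_prod_eq n c
  refine ⟨Φ.trans R, ?_⟩
  rw [Diffeomorph.coe_trans, image_comp, hΦ, hR, range_standardSphere]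

end Rotate

/-! ### Without loss of generality, after a self-diffeomorphism of `S¹ × Sⁿ` -/

section Transport

variable {n : ℕ}

/-- A smooth embedding `Sⁿ → S¹ × Sⁿ` followed by a self-diffeomorphism of `S¹ × Sⁿ` is a smooth
embedding (the tree's `Manifold.IsSmoothEmbedding.diffeomorph_comp`, `ClosedBallProofs.lean`,
specialised). [folklore] -/
theorem isSmoothEmbedding_diffeomorph_comp_circleProdSphere
    (Ψ : (Circle × Metric.sphere (0 : EuclideanSpace ℝ (Fin (n + 1))) 1) ≃ₘ⟮(𝓡 1).prod (𝓡 n),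
        (𝓡 1).prod (𝓡 n)⟯ (Circle × Metric.sphere (0 : EuclideanSpace ℝ (Fin (n + 1))) 1))
    {e : Metric.sphere (0 : EuclideanSpace ℝ (Fin (n + 1))) 1 →
      Circle × Metric.sphere (0 : EuclideanSpace ℝ (Fin (n + 1))) 1}
    (he : Manifold.IsSmoothEmbedding (𝓡 n) ((𝓡 1).prod (𝓡 n)) ∞ e) :
    Manifold.IsSmoothEmbedding (𝓡 n) ((𝓡 1).prod (𝓡 n)) ∞ (Ψ ∘ e) :=
  he.diffeomorph_comp Ψ

/-- The complement of the image of `Ψ ∘ e` is connected iff that of `e` is, for a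
self-diffeomorphism (indeed homeomorphism) `Ψ` of `S¹ × Sⁿ`. [folklore] -/
theorem isConnected_compl_range_diffeomorph_comp_iff
    (Ψ : (Circle × Metric.sphere (0 : EuclideanSpace ℝ (Fin (n + 1))) 1) ≃ₘ⟮(𝓡 1).prod (𝓡 n),
        (𝓡 1).prod (𝓡 n)⟯ (Circle × Metric.sphere (0 : EuclideanSpace ℝ (Fin (n + 1))) 1))
    (e : Metric.sphere (0 : EuclideanSpace ℝ (Fin (n + 1))) 1 →
      Circle × Metric.sphere (0 : EuclideanSpace ℝ (Fin (n + 1))) 1) :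
    IsConnected (range (Ψ ∘ e))ᶜ ↔ IsConnected (range e)ᶜ := by
  rw [range_comp, ← Diffeomorph.coe_toHomeomorph, ← Ψ.toHomeomorph.image_compl,
    Ψ.toHomeomorph.isConnected_image]

/-- The conclusion of Thm. 3.13 for `Ψ ∘ e` and for `e` are equivalent, for a self-diffeomorphism
`Ψ` of `S¹ × Sⁿ` and any target set `T`: some diffeomorphism carries `range (Ψ ∘ e)` onto `T` iff
some diffeomorphism carries `range e` onto `T` (compose with `Ψ`, resp. `Ψ⁻¹`). Together with
`isSmoothEmbedding_diffeomorph_comp_circleProdSphere` and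
`isConnected_compl_range_diffeomorph_comp_iff` this is the formal "without loss of generality we
may replace the sphere by its image under an ambient diffeomorphism" of the printed proof.
[folklore] -/
theorem exists_image_range_diffeomorph_comp_eq_iff
    (Ψ : (Circle × Metric.sphere (0 : EuclideanSpace ℝ (Fin (n + 1))) 1) ≃ₘ⟮(𝓡 1).prod (𝓡 n),
        (𝓡 1).prod (𝓡 n)⟯ (Circle × Metric.sphere (0 : EuclideanSpace ℝ (Fin (n + 1))) 1))
    (e : Metric.sphere (0 : EuclideanSpace ℝ (Fin (n + 1))) 1 →
      Circle × Metric.sphere (0 : EuclideanSpace ℝ (Fin (n + 1))) 1)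
    (T : Set (Circle × Metric.sphere (0 : EuclideanSpace ℝ (Fin (n + 1))) 1)) :
    (∃ Φ : (Circle × Metric.sphere (0 : EuclideanSpace ℝ (Fin (n + 1))) 1) ≃ₘ⟮(𝓡 1).prod (𝓡 n),
        (𝓡 1).prod (𝓡 n)⟯ (Circle × Metric.sphere (0 : EuclideanSpace ℝ (Fin (n + 1))) 1),
        Φ '' range (Ψ ∘ e) = T) ↔
      ∃ Φ : (Circle × Metric.sphere (0 : EuclideanSpace ℝ (Fin (n + 1))) 1) ≃ₘ⟮(𝓡 1).prod (𝓡 n),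
        (𝓡 1).prod (𝓡 n)⟯ (Circle × Metric.sphere (0 : EuclideanSpace ℝ (Fin (n + 1))) 1),
        Φ '' range e = T := by
  constructor
  · rintro ⟨Φ, hΦ⟩
    refine ⟨Ψ.trans Φ, ?_⟩
    rwa [Diffeomorph.coe_trans, image_comp, ← range_comp]
  · rintro ⟨Φ, hΦ⟩
    refine ⟨Ψ.symm.trans Φ, ?_⟩
    rw [Diffeomorph.coe_trans, image_comp, range_comp, Diffeomorph.symm_image_image]
    exact hΦ

end Transport

end Literature.Topology.FourManifolds

end
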